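import Summits.QuantumFields.BalabanUV.T4Continuum.Support.SkeletonFillFullFaces

/-!
# T⁴ programme, node NE3 — kinematic refinement lemma, leaf R1c∕R1d (row NE3-S4d): **ROOT-CLOSENESS OF THE FINE
# PLAQUETTES OF THE CLOSED-FORM FILLING**, cases I–II (file F4b `SkeletonFillFullRoot`)

Cell `pub-balaban`, NE3 formalisation swarm `b2b-balaban-t4-ne3-formalise-*`, unit `b2b-balaban-t4-ne3-formalise-leaf-04`
(LEAF PROVER 04, gen 2), written for row **S4d** of `t4/formal/NE3/LEAVES.md` BY ARRANGEMENT with its holder leaf-07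
(journal OFFER «F3-GRAD SPLIT» ∕ «F3-GRAD PLAN v1», 2026-08-20T08:12Z ∕ 08:19Z).  This is hypothesis `hroot` of
`SkeletonFillFullGradReduce.covGrad_fullFill_le_of_rootClose` (F4a): every fine plaquette of `W := fullFill L T h` with
corner `L•z + q` is within `ρ = O(a₀² + δ)` of ITS OWN CELL'S ROOT `h(z;μ,ν)` — a sharpening of leaf-07's plaquette
RADIUS theorems `SkeletonFillFullNorms.norm_plaq_inner_sub_one_le` ∕ `…farμ…` (F3a) and
`SkeletonFillFullFaces.norm_plaq_farν_sub_one_le` (F3b) («within `a₀ + …` of `1`»): the anchor is the root, so NO term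
linear in `a₀` survives.  The words are leaf-07's `SkeletonFillFull.hol_plaq_fullFill_inner ∕ farμ ∕ farν` (F2) BY NAME and
the chains are theirs with the target moved from `1` to `g = h(z;μ,ν)`: the abelian tally of each word is exactly ONE root.

CONTENT (all [folklore]; `Matrix n n ℂ`; 0 sorry):
§1 `exists_frame_hiProd_step`: `Hμ(z,q)·Hμ(z,q+e_ν)⁻¹ = A₁·g·A₁⁻¹` EXACTLY, `A₁` a partial row product (`‖A₁ − 1‖ ≤ θ`);
§2 `norm_comm4_sub_le`: `‖A·B·A′⁻¹·B⁻¹ − g‖ ≤ 2‖B − 1‖‖A′ − 1‖ + 2‖A₁ − 1‖‖g − 1‖` when `A·A′⁻¹ = A₁gA₁⁻¹`;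
§3 case I **`norm_plaq_inner_sub_root_le`**: `ρ_I = 2θ² + 2θa₀`;
§4 case II **`norm_plaq_farμ_sub_root_le`**: `ρ_II = ρ_I + 2θ_Lθ + d(L−1)δ`;
with `θ = d(L−1)a₀`, `θ_L = d(L−1)La₀`, `δ` = leaf-07's covariant root gradient across the relevant coarse bond.  Case III
(far face in `ν`) is file F4c `SkeletonFillFullRootFar`; case IV (far corner, root identity `h^{L²} = T(∂p)`) is file F4d,
after leaf-07's F3c `SkeletonFillFullSmall`.

HONEST FRAMING.  Norm bookkeeping for a kinematic construction; no minimiser, no conditional of the cell (`BetaPertH`, (B),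
G-an2-4); nothing bears on infinite volume, a mass gap, or the Clay problem; **NE3 is NOT proved**; `SmoothRefine` ∕
`ApproxRefine` NOT proved.  Finite T⁴ rung (B)+1.  ABSOLUTE RULE kept: no printed sentence is a hypothesis; no
`def … : Prop` fact; no `sorry`; axioms ⊆ {propext, Classical.choice, Quot.sound}.  PLACEMENT (human rule 2026-08-19):
under `Summits/QuantumFields/BalabanUV/`; imports leaf-07's F3b only; restates nothing.
HONEST DEPENDENCY: continuum YM on T⁴ ⇐ BetaPertH ∧ nine spine estimates (0/9 proved); BetaPertH ⇐ (D1) ∧ (D4) ∧ CAP+tail;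
G-an2-4 gates asym, D1 and NE2/3/4.
-/

set_option autoImplicit false

open scoped BigOperators Matrix Matrix.Norms.L2Operator
open NormedSpace

namespace Summit.QuantumFields.BalabanUV.T4Continuum.SkeletonFillFullRoot

open Literature.MathematicalPhysics.QuantumFieldTheory.Balaban1983to89
open B7Prop1Explicit B7Prop2Explicit B7Prop1Local MatrixLog UnitaryModel
open T4AveragingDeficitWall hiding Site Plane Plaq Bond
open AveragingDeficitTransport AveragingDeficitNearIdentity GaugeFieldPerturbation
open SkeletonLattice SkeletonFill SkeletonFillFull SkeletonFillFullNorms SkeletonFillFullFaces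

noncomputable section

variable {d : ℕ} {n : Type*} [Fintype n] [DecidableEq n]

/-! ## §1 The row step as an exact conjugate of the root -/

section Frame

variable [Nonempty n] {L : ℕ} {a₀ : ℝ}

/-- **THE ROW STEP IS A CONJUGATE OF THE ROOT**: for `μ < ν` and `q` in the box, `Hμ(z,q)·Hμ(z,q+e_ν)⁻¹ = A₁·h(z;μ,ν)·A₁⁻¹`
EXACTLY, with `A₁` the partial row product over the directions strictly between (in the list order, before) `ν` — unitary and
within `θ = d(L−1)a₀` of `1`.  (The two row products differ by one power of the root in the `ν`-slot:
`(g^k)⁻¹·g^{k+1} = g`.) [folklore] -/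
theorem exists_frame_hiProd_step {h : Site d → Fin d → Fin d → (Matrix n n ℂ)ˣ}
    (hh : ∀ (z : Site d) (κ ν : Fin d), h z κ ν ∈ unitaryUnits (Matrix n n ℂ))
    (ha : ∀ (z : Site d) (κ ν : Fin d), κ < ν → ‖((h z κ ν : (Matrix n n ℂ)ˣ) : Matrix n n ℂ) - 1‖ ≤ a₀) (ha0 : 0 ≤ a₀)
    (z : Site d) {q : Site d} (hq : InBox L q) {μ ν : Fin d} (hμν : μ < ν) :
    ∃ A₁ : (Matrix n n ℂ)ˣ, A₁ ∈ unitaryUnits (Matrix n n ℂ) ∧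
      ‖(A₁ : Matrix n n ℂ) - 1‖ ≤ d * ((L - 1 : ℕ) * a₀) ∧
      hiProd h z q μ * (hiProd h z (q + e ν) μ)⁻¹ = A₁ * h z μ ν * A₁⁻¹ := by
  obtain ⟨l₁, l₂, hν₁, hν₂, hl₁₂, hlen, hsplit⟩ := hiProd_split (G := (Matrix n n ℂ)ˣ) h hμν
  set F : Fin d → (Matrix n n ℂ)ˣ := fun i => ((h z μ i) ^ (q i).toNat)⁻¹ with hFdef
  set F' : Fin d → (Matrix n n ℂ)ˣ := fun i => ((h z μ i) ^ ((q + e ν) i).toNat)⁻¹ with hF'def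
  have hagree : ∀ i, i ≠ ν → F' i = F i := fun i hi => by
    simp only [hFdef, hF'def, Pi.add_apply, e_apply, if_neg hi, add_zero]
  set A₁ := prodOver l₁ F with hA₁def
  set A₂ := prodOver l₂ F with hA₂def
  set g := h z μ ν with hgdef
  have hA : hiProd h z q μ = A₁ * (g ^ (q ν).toNat)⁻¹ * A₂ := hsplit z q
  have hA' : hiProd h z (q + e ν) μ = A₁ * (g ^ ((q ν).toNat + 1))⁻¹ * A₂ := by
    have h1 := hsplit z (q + e ν)
    rw [prodOver_congr (fun i hi => hagree i (fun he => hν₁ (he ▸ hi))),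
      prodOver_congr (fun i hi => hagree i (fun he => hν₂ (he ▸ hi))), toNat_add_e_self (hq ν).1] at h1
    exact h1
  have huF : ∀ i, F i ∈ unitaryUnits (Matrix n n ℂ) := fun i =>
    (unitaryUnits (Matrix n n ℂ)).inv_mem ((unitaryUnits (Matrix n n ℂ)).pow_mem (hh _ _ _) _)
  have huA₁ : A₁ ∈ unitaryUnits (Matrix n n ℂ) := prodOver_mem fun i _ => huF i
  refine ⟨A₁, huA₁, ?_, ?_⟩
  · have hfac : ∀ i, μ < i → ‖(F i : Matrix n n ℂ) - 1‖ ≤ (L - 1 : ℕ) * a₀ := fun i hi => by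
      rw [hFdef]; dsimp only
      rw [norm_val_inv_sub_one ((unitaryUnits (Matrix n n ℂ)).pow_mem (hh _ _ _) _)]
      refine (norm_val_pow_sub_one_le (hh _ _ _) _).trans ?_
      exact mul_le_mul (by exact_mod_cast toNat_le_of_inBox hq i) (ha _ _ _ hi) (norm_nonneg _) (by positivity)
    have h1 : ‖(A₁ : Matrix n n ℂ) - 1‖ ≤ l₁.length * ((L - 1 : ℕ) * a₀) :=
      norm_val_prodOver_sub_one_le (fun i _ => huF i) fun i hi => hfac i (hl₁₂ i (List.mem_append_left _ hi))
    have hl₁d : (l₁.length : ℝ) ≤ d := by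
      have := length_above_le μ; exact_mod_cast (by omega : l₁.length ≤ d)
    exact h1.trans (mul_le_mul_of_nonneg_right hl₁d (by positivity))
  · rw [hA, hA', pow_succ]; group

end Frame

/-! ## §2 The four-factor plaquette word against its root -/

section Comm4

variable [Nonempty n]

/-- **`‖A·B·A′⁻¹·B⁻¹ − g‖ ≤ 2‖B − 1‖‖A′ − 1‖ + 2‖A₁ − 1‖‖g − 1‖`** whenever `A·A′⁻¹ = A₁·g·A₁⁻¹` (unitary units): one
commutator to bring `A′⁻¹` next to `A`, one conjugation defect. [folklore] -/
theorem norm_comm4_sub_le {A B A' A₁ g : (Matrix n n ℂ)ˣ} (hA : A ∈ unitaryUnits (Matrix n n ℂ))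
    (hB : B ∈ unitaryUnits (Matrix n n ℂ)) (hA' : A' ∈ unitaryUnits (Matrix n n ℂ))
    (hA₁ : A₁ ∈ unitaryUnits (Matrix n n ℂ)) (hAA' : A * A'⁻¹ = A₁ * g * A₁⁻¹) :
    ‖((A * B * A'⁻¹ * B⁻¹ : (Matrix n n ℂ)ˣ) : Matrix n n ℂ) - (g : Matrix n n ℂ)‖
      ≤ 2 * ‖(B : Matrix n n ℂ) - 1‖ * ‖(A' : Matrix n n ℂ) - 1‖
        + 2 * ‖(A₁ : Matrix n n ℂ) - 1‖ * ‖(g : Matrix n n ℂ) - 1‖ := by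
  have e1 : (A * B * A'⁻¹ * B⁻¹ : (Matrix n n ℂ)ˣ) = A * (B * A'⁻¹) * B⁻¹ := by group
  have e2 : (A * A'⁻¹ : (Matrix n n ℂ)ˣ) = A * (A'⁻¹ * B) * B⁻¹ := by group
  have step1 : ‖((A * B * A'⁻¹ * B⁻¹ : (Matrix n n ℂ)ˣ) : Matrix n n ℂ) - ((A * A'⁻¹ : (Matrix n n ℂ)ˣ) : Matrix n n ℂ)‖
      ≤ 2 * ‖(B : Matrix n n ℂ) - 1‖ * ‖(A' : Matrix n n ℂ) - 1‖ := by
    rw [e1, e2, norm_val_frame_sub hA ((unitaryUnits (Matrix n n ℂ)).inv_mem hB), Units.val_mul, Units.val_mul]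
    refine (norm_comm_le _ _).trans (le_of_eq ?_)
    rw [norm_val_inv_sub_one hA']
  have step2 : ‖((A * A'⁻¹ : (Matrix n n ℂ)ˣ) : Matrix n n ℂ) - (g : Matrix n n ℂ)‖
      ≤ 2 * ‖(A₁ : Matrix n n ℂ) - 1‖ * ‖(g : Matrix n n ℂ) - 1‖ := by
    rw [hAA']; exact norm_val_conj_sub_le hA₁ g
  exact (norm_sub_le_norm_sub_add_norm_sub _ _ _).trans (add_le_add step1 step2)

end Comm4

/-! ## §3 Case I: inner plaquettes -/

section Cases

variable [Nonempty n] {L : ℕ} {a₀ δ : ℝ}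

/-- **CASE I (INNER PLAQUETTE) AGAINST ITS ROOT** (`μ < ν`, `q_μ, q_ν < L − 1`, other offsets arbitrary):
`‖W(∂p) − h(z;μ,ν)‖ ≤ 2θ² + 2θa₀`, `θ = d(L−1)a₀` — one commutator and one conjugation defect, NO term linear in `a₀`.
[folklore] -/
theorem norm_plaq_inner_sub_root_le {T : Site d → Fin d → (Matrix n n ℂ)ˣ} {h : Site d → Fin d → Fin d → (Matrix n n ℂ)ˣ}
    (hh : ∀ (z : Site d) (κ ν : Fin d), h z κ ν ∈ unitaryUnits (Matrix n n ℂ))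
    (ha : ∀ (z : Site d) (κ ν : Fin d), κ < ν → ‖((h z κ ν : (Matrix n n ℂ)ˣ) : Matrix n n ℂ) - 1‖ ≤ a₀) (ha0 : 0 ≤ a₀)
    {z q : Site d} (hq : InBox L q) {μ ν : Fin d} (hμν : μ < ν) (hμ : q μ < (L : ℤ) - 1)
    (hν : q ν < (L : ℤ) - 1) :
    ‖((hol (fullFill L T h) ((L : ℤ) • z + q) (plaqWord μ ν) : (Matrix n n ℂ)ˣ) : Matrix n n ℂ)
        - ((h z μ ν : (Matrix n n ℂ)ˣ) : Matrix n n ℂ)‖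
      ≤ 2 * (d * ((L - 1 : ℕ) * a₀)) * (d * ((L - 1 : ℕ) * a₀)) + 2 * (d * ((L - 1 : ℕ) * a₀)) * a₀ := by
  have huA : ∀ (q' : Site d) (κ : Fin d), hiProd h z q' κ ∈ unitaryUnits (Matrix n n ℂ) := fun q' κ =>
    prodOver_mem fun i _ => (unitaryUnits (Matrix n n ℂ)).inv_mem ((unitaryUnits (Matrix n n ℂ)).pow_mem (hh _ _ _) _)
  obtain ⟨A₁, huA₁, hA₁, hAA'⟩ := exists_frame_hiProd_step hh ha ha0 z hq hμν
  rw [hol_plaq_fullFill_inner hq hμν hμ hν]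
  refine (norm_comm4_sub_le (huA _ _) (huA _ _) (huA _ _) huA₁ hAA').trans ?_
  have hθB := norm_hiProd_sub_one_le hh ha ha0 z hq ν
  have hθA' := norm_hiProd_sub_one_le hh ha ha0 z (inBox_add_e hq hν) μ
  have hg := ha z μ ν hμν
  have h1 := mul_le_mul hθB hθA' (norm_nonneg _) ((norm_nonneg _).trans hθB)
  have h2 := mul_le_mul hA₁ hg (norm_nonneg _) ((norm_nonneg _).trans hA₁)
  nlinarith [h1, h2]

/-! ## §4 Case II: the far face in the lower direction `μ` -/

/-- **CASE II (FAR FACE IN `μ`) AGAINST ITS ROOT** (`q_μ = L − 1 > q_ν`…): `‖W(∂p) − h(z;μ,ν)‖ ≤ 2θ² + 2θa₀ + 2θ_Lθ +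
d(L−1)δ`, `δ` the covariant root gradient across the coarse bond `(z, μ)` — the neighbour's row product transported by
`Lμ(z,q)·T(z,μ)` is within `2θ_Lθ + d(L−1)δ` of the block's own, then case I. [folklore] -/
theorem norm_plaq_farμ_sub_root_le (hL : 1 ≤ L) {T : Site d → Fin d → (Matrix n n ℂ)ˣ}
    {h : Site d → Fin d → Fin d → (Matrix n n ℂ)ˣ}
    (hT : ∀ (z : Site d) (κ : Fin d), T z κ ∈ unitaryUnits (Matrix n n ℂ))
    (hh : ∀ (z : Site d) (κ ν : Fin d), h z κ ν ∈ unitaryUnits (Matrix n n ℂ))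
    (ha : ∀ (z : Site d) (κ ν : Fin d), κ < ν → ‖((h z κ ν : (Matrix n n ℂ)ˣ) : Matrix n n ℂ) - 1‖ ≤ a₀) (ha0 : 0 ≤ a₀)
    {z : Site d} {μ : Fin d}
    (hδ : ∀ κ ν : Fin d, κ < ν →
      ‖((T z μ * h (z + e μ) κ ν * (T z μ)⁻¹ : (Matrix n n ℂ)ˣ) : Matrix n n ℂ) - ((h z κ ν : (Matrix n n ℂ)ˣ) : Matrix n n ℂ)‖
        ≤ δ) (hδ0 : 0 ≤ δ)
    {q : Site d} (hq : InBox L q) {ν : Fin d} (hμν : μ < ν) (hμ : q μ = (L : ℤ) - 1) (hν : q ν < (L : ℤ) - 1) :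
    ‖((hol (fullFill L T h) ((L : ℤ) • z + q) (plaqWord μ ν) : (Matrix n n ℂ)ˣ) : Matrix n n ℂ)
        - ((h z μ ν : (Matrix n n ℂ)ˣ) : Matrix n n ℂ)‖
      ≤ 2 * (d * ((L - 1 : ℕ) * a₀)) * (d * ((L - 1 : ℕ) * a₀)) + 2 * (d * ((L - 1 : ℕ) * a₀)) * a₀
        + (2 * (d * (((L - 1 : ℕ) * L) * a₀)) * (d * ((L - 1 : ℕ) * a₀)) + d * ((L - 1 : ℕ) * δ)) := by
  have huA : ∀ (z' q' : Site d) (κ : Fin d), hiProd h z' q' κ ∈ unitaryUnits (Matrix n n ℂ) := fun z' q' κ =>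
    prodOver_mem fun i _ => (unitaryUnits (Matrix n n ℂ)).inv_mem ((unitaryUnits (Matrix n n ℂ)).pow_mem (hh _ _ _) _)
  have huL : ∀ (q' : Site d) (κ : Fin d), loProd L h z q' κ ∈ unitaryUnits (Matrix n n ℂ) := fun q' κ =>
    prodOver_mem fun i _ => (unitaryUnits (Matrix n n ℂ)).pow_mem (hh _ _ _) _
  -- abbreviations (as in F3a)
  set A := hiProd h z q μ with hAdef
  set B := hiProd h z q ν with hBdef
  set A' := hiProd h z (q + e ν) μ with hA'def
  set B₁ := hiProd h (z + e μ) q ν with hB₁def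
  set Λ := loProd L h z q μ with hΛdef
  set t := T z μ with htdef
  set M : (Matrix n n ℂ)ˣ := Λ * t * B₁ * (Λ * t)⁻¹ with hMdef
  have huM : M ∈ unitaryUnits (Matrix n n ℂ) := by
    rw [hMdef]
    exact (unitaryUnits (Matrix n n ℂ)).mul_mem ((unitaryUnits (Matrix n n ℂ)).mul_mem
      ((unitaryUnits (Matrix n n ℂ)).mul_mem (huL _ _) (hT _ _)) (huA _ _ _))
      ((unitaryUnits (Matrix n n ℂ)).inv_mem ((unitaryUnits (Matrix n n ℂ)).mul_mem (huL _ _) (hT _ _)))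
  have hword : hiProd h z q μ * (loProd L h z q μ * T z μ) * hiProd h (z + e μ) q ν
      * ((loProd L h z q μ * T z μ)⁻¹ * (hiProd h z (q + e ν) μ)⁻¹) * (hiProd h z q ν)⁻¹
      = A * M * A'⁻¹ * B⁻¹ := by
    simp only [hMdef, hAdef, hBdef, hA'def, hB₁def, hΛdef, htdef]; group
  rw [hol_plaq_fullFill_farμ hL hq hμν hμ hν, hword]
  -- sizes
  have hθB : ‖(B : Matrix n n ℂ) - 1‖ ≤ d * ((L - 1 : ℕ) * a₀) := norm_hiProd_sub_one_le hh ha ha0 z hq ν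
  have hθA' : ‖(A' : Matrix n n ℂ) - 1‖ ≤ d * ((L - 1 : ℕ) * a₀) := norm_hiProd_sub_one_le hh ha ha0 z (inBox_add_e hq hν) μ
  have hθΛ : ‖(Λ : Matrix n n ℂ) - 1‖ ≤ d * (((L - 1 : ℕ) * L) * a₀) := norm_loProd_sub_one_le hh ha ha0 z hq μ
  have hθB₁ : ‖((t * B₁ * t⁻¹ : (Matrix n n ℂ)ˣ) : Matrix n n ℂ) - 1‖ ≤ d * ((L - 1 : ℕ) * a₀) := by
    have e1 : ((t * B₁ * t⁻¹ : (Matrix n n ℂ)ˣ) : Matrix n n ℂ) - 1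
        = ((t * B₁ * t⁻¹ : (Matrix n n ℂ)ˣ) : Matrix n n ℂ) - ((t * 1 * t⁻¹ : (Matrix n n ℂ)ˣ) : Matrix n n ℂ) := by
      rw [mul_one, mul_inv_cancel, Units.val_one]
    rw [e1, norm_val_frame_sub (hT _ _) ((unitaryUnits (Matrix n n ℂ)).inv_mem (hT _ _)), Units.val_one]
    exact norm_hiProd_sub_one_le hh ha ha0 (z + e μ) hq ν
  have hδB : ‖((t * B₁ * t⁻¹ : (Matrix n n ℂ)ˣ) : Matrix n n ℂ) - (B : Matrix n n ℂ)‖ ≤ d * ((L - 1 : ℕ) * δ) :=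
    norm_conj_hiProd_sub_le hh (hT _ _) hδ hδ0 hq ν
  -- `‖M − B‖ ≤ 2θ_Lθ + d(L−1)δ`
  have hMB : ‖(M : Matrix n n ℂ) - (B : Matrix n n ℂ)‖
      ≤ 2 * (d * (((L - 1 : ℕ) * L) * a₀)) * (d * ((L - 1 : ℕ) * a₀)) + d * ((L - 1 : ℕ) * δ) := by
    have e1 : M = Λ * (t * B₁ * t⁻¹) * Λ⁻¹ := by rw [hMdef]; group
    calc ‖(M : Matrix n n ℂ) - (B : Matrix n n ℂ)‖
        ≤ ‖(M : Matrix n n ℂ) - ((t * B₁ * t⁻¹ : (Matrix n n ℂ)ˣ) : Matrix n n ℂ)‖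
          + ‖((t * B₁ * t⁻¹ : (Matrix n n ℂ)ˣ) : Matrix n n ℂ) - (B : Matrix n n ℂ)‖ := norm_sub_le_norm_sub_add_norm_sub _ _ _
      _ ≤ 2 * ‖(Λ : Matrix n n ℂ) - 1‖ * ‖((t * B₁ * t⁻¹ : (Matrix n n ℂ)ˣ) : Matrix n n ℂ) - 1‖ + d * ((L - 1 : ℕ) * δ) := by
          rw [e1]; exact add_le_add (norm_val_conj_sub_le (huL _ _) _) hδB
      _ ≤ _ := by
          have h1 := mul_le_mul hθΛ hθB₁ (norm_nonneg _) ((norm_nonneg _).trans hθΛ)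
          nlinarith [h1]
  -- replace `M` by `B` inside the frame `A · _ · A′⁻¹B⁻¹`, then case I
  obtain ⟨A₁, huA₁, hA₁, hAA'⟩ := exists_frame_hiProd_step hh ha ha0 z hq hμν
  have e3 : (A * M * A'⁻¹ * B⁻¹ : (Matrix n n ℂ)ˣ) = A * M * (A'⁻¹ * B⁻¹) := by group
  have e4 : (A * B * A'⁻¹ * B⁻¹ : (Matrix n n ℂ)ˣ) = A * B * (A'⁻¹ * B⁻¹) := by group
  have step1 : ‖((A * M * A'⁻¹ * B⁻¹ : (Matrix n n ℂ)ˣ) : Matrix n n ℂ) - ((A * B * A'⁻¹ * B⁻¹ : (Matrix n n ℂ)ˣ) : Matrix n n ℂ)‖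
      ≤ 2 * (d * (((L - 1 : ℕ) * L) * a₀)) * (d * ((L - 1 : ℕ) * a₀)) + d * ((L - 1 : ℕ) * δ) := by
    rw [e3, e4, norm_val_frame_sub (huA _ _ _) ((unitaryUnits (Matrix n n ℂ)).mul_mem
      ((unitaryUnits (Matrix n n ℂ)).inv_mem (huA _ _ _)) ((unitaryUnits (Matrix n n ℂ)).inv_mem (huA _ _ _)))]
    exact hMB
  have step2 := norm_comm4_sub_le (B := B) (g := h z μ ν) (huA z q μ) (huA z q ν) (huA z (q + e ν) μ) huA₁ hAA'
  have hg := ha z μ ν hμν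
  have h1 := mul_le_mul hθB hθA' (norm_nonneg _) ((norm_nonneg _).trans hθB)
  have h2 := mul_le_mul hA₁ hg (norm_nonneg _) ((norm_nonneg _).trans hA₁)
  calc ‖((A * M * A'⁻¹ * B⁻¹ : (Matrix n n ℂ)ˣ) : Matrix n n ℂ) - ((h z μ ν : (Matrix n n ℂ)ˣ) : Matrix n n ℂ)‖
      ≤ ‖((A * M * A'⁻¹ * B⁻¹ : (Matrix n n ℂ)ˣ) : Matrix n n ℂ) - ((A * B * A'⁻¹ * B⁻¹ : (Matrix n n ℂ)ˣ) : Matrix n n ℂ)‖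
        + ‖((A * B * A'⁻¹ * B⁻¹ : (Matrix n n ℂ)ˣ) : Matrix n n ℂ) - ((h z μ ν : (Matrix n n ℂ)ˣ) : Matrix n n ℂ)‖ :=
        norm_sub_le_norm_sub_add_norm_sub _ _ _
    _ ≤ (2 * (d * (((L - 1 : ℕ) * L) * a₀)) * (d * ((L - 1 : ℕ) * a₀)) + d * ((L - 1 : ℕ) * δ))
        + (2 * (d * ((L - 1 : ℕ) * a₀)) * (d * ((L - 1 : ℕ) * a₀)) + 2 * (d * ((L - 1 : ℕ) * a₀)) * a₀) := by
        refine add_le_add step1 (step2.trans ?_)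
        nlinarith [h1, h2]
    _ = _ := by ring

end Cases

end

end Summit.QuantumFields.BalabanUV.T4Continuum.SkeletonFillFullRoot
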